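import Literature.AlgebraicGeometry.Resolution.WeightedCentreBottomExact
import Literature.AlgebraicGeometry.Resolution.WeightedCentreZKernelFlow
import HarnessLib

/-!
# Weighted centres — THEOREM A⁺: the eigen form inside `K` (L2 with heavy fixed slots)

Instrument for engine 1's `W(f)` TOY MODEL (cell `pub-rosobs`, LF-MODEL-eng1-g45 §6.2 THEOREM A⁺: "apply L2 inside `K = Stab(g) ∩ graded ∩ baseFixing ∩ 𝔄_1 ∩ Fix(V)` …
for `r ≥ 3` the error term lies in `K ∩ 𝔄_{p+2} = 1`"), NOT a resolution theorem and NOT about the invariant of [AbramovichTemkinWlodarczyk2024].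

* `orbitClosure_le_K` — the torus orbit group of `X₀ ∈ K ∩ pureSlot z r` stays in `K ∩ pureSlot z r` (all conditions are torus-stable);
* `eigen_lift_orbit_exact_or_fix` — `EigenLift.eigen_lift_orbit_exact` with the weight bound `w i < b` relaxed to "`w i < b` OR `ε_i` is a fixed heavy slot"
  (`WeightedCentreBottomExact.eq_one_of_mem_level_or_fix` replaces `eq_one_of_mem_level`): an `X'` in the orbit group, `X' ∈ 𝔄_r`, same bottom character at `z`,
  EXACT eigen-relation `E_{μ₀}(X') = X'^{n₀}` — the input of `WeightedCentreBottomAPlus.false_of_three_le` (`b = p + 2`, `r ≥ 3`).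

References: [Lang2002, Ch. I §§3, 6, Ch. IV §1, Ch. V §5]; [SerreLocalFields1979, Ch. II §4 Lemma 1]; [AbramovichTemkinWlodarczyk2024, §5.1 (p. 1575)].
-/

namespace Literature.AlgebraicGeometry.Resolution.WeightedBlowup.BottomClimb

open Polynomial OrderFiltration LevelProjection EigenLiftLevels EigenLift TruncatedFlow ZKernel

variable {k : Type*} [CommRing k] {ι : Type*} {w : ι → ℚ} (p : ℕ) [Fact p.Prime] [CharP k p]

/-- **The orbit group of `X₀ ∈ K ∩ pureSlot z r` stays in `K ∩ pureSlot z r`** (`K = graded ∩ baseFixing ∩ 𝔄_1 ∩ Fix(V) ∩ Stab(g)`; all six conditions are torus-stable —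
bookkeeping as `ZKernel.orbitGroup_le`). [cite: Lang2002, Ch. I §3; SerreLocalFields1979, Ch. II §4 Lemma 1] -/
theorem orbitClosure_le_K {V : Set ι} {g : MvPolynomial ι k} {z : ι} {r : ℕ} {X₀ : (MvPolynomial ι k)[X] ≃+* (MvPolynomial ι k)[X]}
    (hg : X₀ ∈ graded w (1 : ℚ)) (hb : X₀ ∈ baseFixing) (h1 : X₀ ∈ level (X : (MvPolynomial ι k)[X]) 1) (hV : X₀ ∈ fixSlots V)
    (hfix : X₀ (C g) = C g) (hz : X₀ ∈ pureSlot z r) :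
    Subgroup.closure (Set.range fun ν : (ZMod p)ˣ => scaleConj (castUnit p ν) X₀) ≤
      graded w (1 : ℚ) ⊓ baseFixing ⊓ level (X : (MvPolynomial ι k)[X]) 1 ⊓ fixSlots V ⊓
        MulAction.stabilizer ((MvPolynomial ι k)[X] ≃+* (MvPolynomial ι k)[X]) (C g : (MvPolynomial ι k)[X]) ⊓ pureSlot z r := by
  refine orbitClosure_le X₀ hb _ (fun c A hA _ => ?_) ⟨⟨⟨⟨⟨hg, hb⟩, h1⟩, hV⟩, MulAction.mem_stabilizer_iff.mpr hfix⟩, hz⟩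
  exact ⟨⟨⟨⟨⟨scaleConj_mem_graded _ hA.1.1.1.1.2 hA.1.1.1.1.1, scaleConj_mem_baseFixing _ hA.1.1.1.1.2⟩,
    scaleConj_mem_level _ hA.1.1.1.1.2 hA.1.1.1.2⟩, scaleConj_mem_fixSlots _ hA.1.1.2⟩, scaleConj_mem_stabilizer _ hA.1.2⟩,
    scaleConj_mem_pureSlot _ hA.2⟩

/-- **L2 INSIDE `K`, EXACT FORM** (LF-MODEL-eng1-g45 §6.2 / RE-DERIVATION-eng1-g43 §3.2 (c)): for `X₀ ∈ K ∩ pureSlot z r`, `2 ≤ r ≤ p − 1`, `r + 1 ≤ b ≤ r + (p − 1)` and every slot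
of weight `≥ b` a fixed heavy slot (`i ∈ V`), the orbit group contains `X' ∈ 𝔄_r` with the same bottom character at `z` and the EXACT relation `E_{μ₀}(X') = X'^{n₀}`
(`eigen_lift_orbit`; the error `h ∈ 𝔄_b ∩ K` is `1` by `eq_one_of_mem_level_or_fix`).  Instrument for engine 1's `W(f)` toy model, NOT a resolution theorem.
[cite: Lang2002, Ch. I §6, Ch. IV §1, Ch. V §5; AbramovichTemkinWlodarczyk2024, §5.1 (p. 1575)] -/
theorem eigen_lift_orbit_exact_or_fix (hw : ∀ i, 0 ≤ w i) {V : Set ι} {g : MvPolynomial ι k} {z : ι} {r : ℕ}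
    {X₀ : (MvPolynomial ι k)[X] ≃+* (MvPolynomial ι k)[X]} (hg : X₀ ∈ graded w (1 : ℚ)) (hb : X₀ ∈ baseFixing)
    (h1 : X₀ ∈ level (X : (MvPolynomial ι k)[X]) 1) (hV : X₀ ∈ fixSlots V) (hfix : X₀ (C g) = C g) (hz : X₀ ∈ pureSlot z r)
    (hr : 2 ≤ r) (hrp : r ≤ p - 1) {b : ℕ} (hrb : r + 1 ≤ b) (hbp : b ≤ r + (p - 1)) (hVw : ∀ i, w i < (b : ℚ) ∨ i ∈ V)
    {μ₀ : (ZMod p)ˣ} (hμ₀ : orderOf μ₀ = p - 1) (n₀ : ℕ) (hn₀ : (n₀ : ZMod p) = (μ₀ : ZMod p) ^ r) :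
    ∃ X' ∈ Subgroup.closure (Set.range fun ν : (ZMod p)ˣ => scaleConj (castUnit p ν) X₀),
      X' ∈ level (X : (MvPolynomial ι k)[X]) r ∧ bottom r X' z = bottom r X₀ z ∧ scaleConj (castUnit p μ₀) X' = X' ^ n₀ := by
  obtain ⟨X', hX'H, hX'r, hc, h, hhH, hhb, hfin⟩ := eigen_lift_orbit X₀ hb h1 (Z := {z})
    (fun z' hz' => by rw [Set.mem_singleton_iff.mp hz']; exact hz) hr hrp μ₀ n₀ hn₀ hrb
    (fun m hm1 hm2 => nonresonant_of_orderOf hμ₀ (by omega) (by omega))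
  have hhK := orbitClosure_le_K p hg hb h1 hV hfix hz hhH
  have h1' : h = 1 :=
    eq_one_of_mem_level_or_fix hw hhK.1.1.1.1.1 hhK.1.1.1.1.2 hhb fun i => (hVw i).imp_right fun hi => hhK.1.1.2 i hi
  exact ⟨X', hX'H, hX'r, hc z rfl, by rw [hfin, h1', mul_one]⟩

end Literature.AlgebraicGeometry.Resolution.WeightedBlowup.BottomClimb
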